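import Summits.ValiantsHypothesis.ValiantsHypothesis.Theorems.BarrierLeverChowBenchmarkPairsPeelRows

/-!
# Route BarrierLever — item 22038 `ChowBenchmarkPairs`, line `moore-peel`: DIRICHLET-WEIGHTED segment entries and the
# one-coordinate expansion identity (the algebra behind multi-point coordinate splits)

Helper file (`--supports stmt-ValiantsHypothesis-22038`; cell valiant-natproofs, rung V4; seat val-np-p4 gen 23).  Closes NO item.

The segment-moment entry of the line, `segE P S T = Σ_{g : T → S} ∏_{c∈T} P_{g(c),c} · ∏_{a∈S} |g⁻¹(a)|!`, is the
coefficient `[θ^T] ∏_{a∈S} R_a` with `R_a = (1 − Σ_c P_{ac} θ_c)^{-1}` in the zeon algebra.  Degenerating ONE COORDINATE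
`c` of ALL points at once (the seat's multi-point «coordinate split», memo HOME/val-np-p4/g23/) produces the coefficients
`[θ^{T+c}] ∏_a R_a = Σ_{a∈S} P_{ac} · [θ^T] R_a ∏_{b∈S} R_b`, i.e. products with a REPEATED factor `R_a²`, and after `j`
splits exponents up to `j+1`: the natural closed class is `R^w := ∏_a R_a^{w_a}` for weights `w : π → ℕ`, whose coefficients
are the **Dirichlet-weighted entries**
`dirE P S w T = Σ_{g : T → S} ∏_{c∈T} P_{g(c),c} · ∏_{a∈S} (w_a)^{(|g⁻¹(a)|)}` (rising factorials; `(1−p)^{−w} = Σ_m w^{(m)} p^m/m!`),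
equivalently `(|T|+|w|−1)!/(|w|−1)!` times the Dirichlet(`w`)-mean of `z^T` over the simplex/segment spanned by the points of
`S` — for `w ≡ 1` exactly `segE` (`dirE_one`).  This file proves the two identities every split uses:

* `dirE_eq_zero_of_mem` — if the column contains `c` and every point of the row vanishes at coordinate `c`, the entry is `0`
  (rows supported on the height-zero layer have no `c`-part);
* `dirE_insert` — **the one-coordinate expansion** `dirE P S w (T+c) = Σ_{a∈S} w_a · P_{ac} · dirE P S (w + δ_a) T` for
  `c ∉ T` (the `c`-part of a row is a height-weighted sum of the same row with ONE weight raised: `D_c R^w = Σ_a w_a P_{ac} R^{w+e_a}`).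

WHAT THIS IS NOT: no stub of the line is closed; nothing on crux stmt-ValiantsHypothesis-14610 or on `VP` versus `VNP`.
-/

set_option linter.dupNamespace false

namespace Summit.ValiantsHypothesis.ValiantsHypothesis.Theorems.BarrierLever.ChowBenchmarkSplit

open Finset
open Summit.ValiantsHypothesis.ValiantsHypothesis.Theorems.BarrierLever.ChowBenchmarkPeel (segE)

variable {κ : Type*} [DecidableEq κ] {R : Type*} [CommRing R] {π : Type*} [DecidableEq π]

/-! ## 1. Dirichlet-weighted entries -/

/-- **Dirichlet-weighted segment entry** `Σ_{g : T → S} ∏_{c∈T} P_{g(c),c} · ∏_{a∈S} (w a)^{(|g⁻¹(a)|)}` — the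
coefficient `[θ^T] ∏_{a∈S} R_a^{w_a}`, `R_a = (1 − Σ_c P_{ac}θ_c)^{-1}` (rising factorials `Nat.ascFactorial`). -/
def dirE (P : π → κ → R) (S : Finset π) (w : π → ℕ) (T : Finset κ) : R :=
  ∑ g : (↥T → ↥S), (∏ c : ↥T, P (g c) c) *
    ∏ a : ↥S, (((w a).ascFactorial (Finset.univ.filter fun c : ↥T => g c = a).card : ℕ) : R)

/-- With all weights `1` the Dirichlet entry is the segment entry `segE` (`1^{(m)} = m!`). -/
theorem dirE_one (P : π → κ → R) (S : Finset π) (T : Finset κ) :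
    dirE P S (fun _ => 1) T = segE P S T := by
  unfold dirE segE
  refine Finset.sum_congr rfl fun g _ => ?_
  congr 1
  refine Finset.prod_congr rfl fun a _ => ?_
  rw [Nat.one_ascFactorial]

/-- Ring homomorphisms act on Dirichlet entries entrywise on the table. -/
theorem map_dirE {R' : Type*} [CommRing R'] (f : R →+* R') (P : π → κ → R) (S : Finset π) (w : π → ℕ)
    (T : Finset κ) : f (dirE P S w T) = dirE (fun a c => f (P a c)) S w T := by
  unfold dirE
  rw [map_sum]
  refine Finset.sum_congr rfl fun g _ => ?_
  rw [map_mul, map_prod, map_prod]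
  congr 1
  exact Finset.prod_congr rfl fun a _ => by rw [map_natCast]

/-- **Height-zero rows have no `c`-part**: if `c ∈ T` and every point of `S` vanishes at coordinate `c`, then
`dirE P S w T = 0`. -/
theorem dirE_eq_zero_of_mem (P : π → κ → R) (S : Finset π) (w : π → ℕ) (T : Finset κ) {c : κ} (hc : c ∈ T)
    (h0 : ∀ a ∈ S, P a c = 0) : dirE P S w T = 0 := by
  unfold dirE
  refine Finset.sum_eq_zero fun g _ => ?_
  have : (∏ x : ↥T, P (g x) x) = 0 := by
    apply Finset.prod_eq_zero (Finset.mem_univ (⟨c, hc⟩ : ↥T))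
    exact h0 _ (g ⟨c, hc⟩).2
  rw [this, zero_mul]

/-! ## 2. The one-coordinate expansion -/

section Insert

variable (S : Finset π) {T : Finset κ} {c : κ}

/-- Functions on `↥(insert c T)` are a value at `c` and a function on `↥T` (`c ∉ T`). -/
noncomputable def splitFun (hc : c ∉ T) : (↥(insert c T) → ↥S) ≃ ↥S × (↥T → ↥S) :=
  (Equiv.arrowCongr (Finset.subtypeInsertEquivOption hc) (Equiv.refl ↥S)).trans Equiv.piOptionEquivProd

omit [DecidableEq π] in
/-- The recombined function at the new coordinate. -/
theorem splitFun_symm_apply_new (hc : c ∉ T) (a : ↥S) (g : ↥T → ↥S) :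
    (splitFun S hc).symm (a, g) ⟨c, Finset.mem_insert_self c T⟩ = a := by
  simp [splitFun, Equiv.arrowCongr, Equiv.piOptionEquivProd, Finset.subtypeInsertEquivOption]

omit [DecidableEq π] in
/-- The recombined function at an old coordinate. -/
theorem splitFun_symm_apply_old (hc : c ∉ T) (a : ↥S) (g : ↥T → ↥S) (t : ↥T) :
    (splitFun S hc).symm (a, g) ⟨t, Finset.mem_insert_of_mem t.2⟩ = g t := by
  have ht : (t : κ) ≠ c := fun e => hc (e ▸ t.2)
  simp [splitFun, Equiv.arrowCongr, Equiv.piOptionEquivProd, Finset.subtypeInsertEquivOption, ht]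

omit [DecidableEq π] in
/-- A sum over `↥(insert c T)` splits into the value at `c` and the sum over `↥T`. -/
theorem sum_insert_subtype {M : Type*} [AddCommMonoid M] (hc : c ∉ T) (f : ↥(insert c T) → M) :
    ∑ x : ↥(insert c T), f x = f ⟨c, Finset.mem_insert_self c T⟩ + ∑ t : ↥T, f ⟨t, Finset.mem_insert_of_mem t.2⟩ := by
  rw [← Fintype.sum_equiv (Finset.subtypeInsertEquivOption hc).symm (fun o => f ((Finset.subtypeInsertEquivOption hc).symm o)) f
    (fun _ => rfl), Fintype.sum_option]
  rfl

omit [DecidableEq π] in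
/-- A product over `↥(insert c T)` splits into the value at `c` and the product over `↥T`. -/
theorem prod_insert_subtype {M : Type*} [CommMonoid M] (hc : c ∉ T) (f : ↥(insert c T) → M) :
    ∏ x : ↥(insert c T), f x = f ⟨c, Finset.mem_insert_self c T⟩ * ∏ t : ↥T, f ⟨t, Finset.mem_insert_of_mem t.2⟩ := by
  rw [← Fintype.prod_equiv (Finset.subtypeInsertEquivOption hc).symm (fun o => f ((Finset.subtypeInsertEquivOption hc).symm o)) f
    (fun _ => rfl), Fintype.prod_option]
  rfl

/-- Fibre sizes of the recombined function: `|G⁻¹(b)| = [a = b] + |g⁻¹(b)|`. -/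
theorem card_fiber_splitFun (hc : c ∉ T) (a b : ↥S) (g : ↥T → ↥S) :
    (Finset.univ.filter fun x : ↥(insert c T) => (splitFun S hc).symm (a, g) x = b).card =
      (if a = b then 1 else 0) + (Finset.univ.filter fun t : ↥T => g t = b).card := by
  rw [Finset.card_filter, Finset.card_filter, sum_insert_subtype hc, splitFun_symm_apply_new]
  congr 1
  exact Finset.sum_congr rfl fun t _ => by rw [splitFun_symm_apply_old]

/-- Raising one weight: `w_b^{([a=b]+m)} = (w_a if a = b, else 1) · (w + δ_a)_b^{(m)}`. -/
theorem ascFactorial_update (w : π → ℕ) (a b : ↥S) (m : ℕ) :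
    (w b).ascFactorial ((if a = b then 1 else 0) + m) =
      (if a = b then w a else 1) * (Function.update w (a : π) (w a + 1) b).ascFactorial m := by
  by_cases hab : a = b
  · subst hab
    rw [if_pos rfl, if_pos rfl, Function.update_self, Nat.add_comm, Nat.ascFactorial_succ,
      ← Nat.succ_ascFactorial]
  · have hne : (b : π) ≠ (a : π) := fun e => hab (Subtype.ext e.symm)
    rw [if_neg hab, if_neg hab, Function.update_of_ne hne, Nat.zero_add, one_mul]

/-- **THE ONE-COORDINATE EXPANSION.**  For `c ∉ T`:
`dirE P S w (insert c T) = Σ_{a∈S} w_a · P_{ac} · dirE P S (w + δ_a) T` — the coefficient `[θ^{T+c}] R^w` is the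
height-weighted sum of the same row with the weight of ONE point raised (`D_c (1−p_a)^{−w_a} = w_a P_{ac} (1−p_a)^{−w_a−1}`). -/
theorem dirE_insert (P : π → κ → R) (w : π → ℕ) (hc : c ∉ T) :
    dirE P S w (insert c T) =
      ∑ a : ↥S, (w a : R) * P a c * dirE P S (Function.update w (a : π) (w a + 1)) T := by
  classical
  unfold dirE
  rw [← Fintype.sum_equiv (splitFun S hc).symm _ _ (fun _ => rfl), Fintype.sum_prod_type]
  refine Finset.sum_congr rfl fun a _ => ?_
  rw [Finset.mul_sum]
  refine Finset.sum_congr rfl fun g _ => ?_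
  -- the coordinate product
  rw [prod_insert_subtype hc, splitFun_symm_apply_new]
  have hprod : (∏ t : ↥T, P ((splitFun S hc).symm (a, g) ⟨t, Finset.mem_insert_of_mem t.2⟩) (t : κ)) =
      ∏ t : ↥T, P (g t) t := Finset.prod_congr rfl fun t _ => by rw [splitFun_symm_apply_old]
  rw [hprod]
  -- the weight product
  have hw : (∏ b : ↥S, (((w b).ascFactorial
      (Finset.univ.filter fun x : ↥(insert c T) => (splitFun S hc).symm (a, g) x = b).card : ℕ) : R)) =
      (w a : R) * ∏ b : ↥S, (((Function.update w (a : π) (w a + 1) b).ascFactorial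
        (Finset.univ.filter fun t : ↥T => g t = b).card : ℕ) : R) := by
    rw [Finset.prod_congr rfl fun b _ => by rw [card_fiber_splitFun S hc a b g, ascFactorial_update S w a b, Nat.cast_mul],
      Finset.prod_mul_distrib]
    congr 1
    rw [Finset.prod_eq_single a]
    · rw [if_pos rfl]
    · intro b _ hb
      rw [if_neg (Ne.symm hb), Nat.cast_one]
    · intro h
      exact absurd (Finset.mem_univ a) h
  rw [hw]
  ring

end Insert


/-- Entries only read the table at the coordinates of their column. -/
theorem dirE_congr {P Q : π → κ → R} (S : Finset π) (w : π → ℕ) {T : Finset κ}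
    (h : ∀ a, ∀ c ∈ T, P a c = Q a c) : dirE P S w T = dirE Q S w T := by
  unfold dirE
  refine Finset.sum_congr rfl fun g _ => ?_
  congr 1
  exact Finset.prod_congr rfl fun x _ => h _ _ x.2

/-! ## 3. Replacing one coordinate by heights; the pure split is block triangular -/

/-- The table `P` with coordinate `c` replaced by the heights `f`. -/
def setCol (P : π → κ → R) (c : κ) (f : π → R) : π → κ → R := fun a c' => if c' = c then f a else P a c'

omit [CommRing R] [DecidableEq π] in
/-- At coordinate `c` the new table reads the heights. -/
@[simp] theorem setCol_self (P : π → κ → R) (c : κ) (f : π → R) (a : π) : setCol P c f a c = f a := by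
  simp [setCol]

/-- Columns avoiding `c` do not see the heights. -/
theorem dirE_setCol_of_not_mem (P : π → κ → R) (c : κ) (f : π → R) (S : Finset π) (w : π → ℕ) {T : Finset κ}
    (hc : c ∉ T) : dirE (setCol P c f) S w T = dirE P S w T :=
  dirE_congr S w fun a c' hc' => by
    have : c' ≠ c := fun e => hc (e ▸ hc')
    simp [setCol, this]

/-- **PURE SPLIT = BLOCK TRIANGULARITY.**  Rows of the first kind have all their points at height `0` in coordinate `c`
(`h0`), columns of the second kind all contain `c` (`hT₂`): then the upper-right block vanishes (`dirE_eq_zero_of_mem`) and the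
determinant of the whole matrix is the product of the two diagonal blocks — «rows inside the zero layer × `c`-free columns»
times «the other rows × `c`-columns». -/
theorem det_fromBlocks_split {ι₁ ι₂ : Type*} [Fintype ι₁] [Fintype ι₂] [DecidableEq ι₁] [DecidableEq ι₂]
    (P : π → κ → R) (S₁ : ι₁ → Finset π) (w₁ : ι₁ → π → ℕ) (S₂ : ι₂ → Finset π) (w₂ : ι₂ → π → ℕ)
    (T₁ : ι₁ → Finset κ) (T₂ : ι₂ → Finset κ) (c : κ) (hT₂ : ∀ j, c ∈ T₂ j) (h0 : ∀ i, ∀ a ∈ S₁ i, P a c = 0) :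
    (Matrix.fromBlocks (Matrix.of fun i j => dirE P (S₁ i) (w₁ i) (T₁ j)) (Matrix.of fun i j => dirE P (S₁ i) (w₁ i) (T₂ j))
      (Matrix.of fun i j => dirE P (S₂ i) (w₂ i) (T₁ j)) (Matrix.of fun i j => dirE P (S₂ i) (w₂ i) (T₂ j))).det =
    (Matrix.of fun i j : ι₁ => dirE P (S₁ i) (w₁ i) (T₁ j)).det *
      (Matrix.of fun i j : ι₂ => dirE P (S₂ i) (w₂ i) (T₂ j)).det := by
  have hz : (Matrix.of fun (i : ι₁) (j : ι₂) => dirE P (S₁ i) (w₁ i) (T₂ j)) = 0 := by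
    ext i j
    rw [Matrix.of_apply, Matrix.zero_apply]
    exact dirE_eq_zero_of_mem P (S₁ i) (w₁ i) (T₂ j) (hT₂ j) (h0 i)
  rw [hz, Matrix.det_fromBlocks_zero₁₂]

/-! ## 4. The `c`-block under dominant heights: the leading term -/

section Dominance

open Polynomial

variable {ι : Type*} [Fintype ι] [DecidableEq ι]

/-- The symbolic table: old coordinates constant, coordinate `c` carries the heights `X^{r a}`. -/
noncomputable def heightTable (P : π → κ → R) (c : κ) (r : π → ℕ) : π → κ → R[X] :=
  setCol (fun a c' => C (P a c')) c (fun a => X ^ r a)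

/-- **Entries of the `c`-block at the height table.**  For `c ∉ T'`:
`dirE (heightTable P c r) S w (T'+c) = Σ_{a∈S} w_a · X^{r a} · C (dirE P S (w+δ_a) T')`. -/
theorem dirE_heightTable_insert (P : π → κ → R) (c : κ) (r : π → ℕ) (S : Finset π) (w : π → ℕ) {T' : Finset κ}
    (hc : c ∉ T') :
    dirE (heightTable P c r) S w (insert c T') =
      ∑ a : ↥S, (w a : R[X]) * X ^ r a * C (dirE P S (Function.update w (a : π) (w a + 1)) T') := by
  rw [dirE_insert S _ _ hc]
  refine Finset.sum_congr rfl fun a _ => ?_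
  rw [heightTable, setCol_self, dirE_setCol_of_not_mem _ _ _ _ _ hc, ← map_dirE C]

/-- The `c`-block row of a row with dominant point `y` (`r y ≤ r a` on `S`), with the common factor `X^{r y}` removed. -/
noncomputable def redEntry (P : π → κ → R) (r : π → ℕ) (S : Finset π) (w : π → ℕ) (y : π) (T' : Finset κ) : R[X] :=
  ∑ a : ↥S, (w a : R[X]) * X ^ (r a - r y) * C (dirE P S (Function.update w (a : π) (w a + 1)) T')

/-- Factoring the dominant height out of a `c`-block entry. -/
theorem dirE_heightTable_eq_mul_redEntry (P : π → κ → R) (c : κ) (r : π → ℕ) (S : Finset π) (w : π → ℕ) (y : π)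
    (hy : ∀ a ∈ S, r y ≤ r a) {T' : Finset κ} (hc : c ∉ T') :
    dirE (heightTable P c r) S w (insert c T') = X ^ r y * redEntry P r S w y T' := by
  rw [dirE_heightTable_insert P c r S w hc, redEntry, Finset.mul_sum]
  refine Finset.sum_congr rfl fun a _ => ?_
  have hsplit : (X : R[X]) ^ r a = X ^ (r a - r y) * X ^ r y := by
    rw [← pow_add, Nat.sub_add_cancel (hy a a.2)]
  rw [hsplit]
  ring

/-- At `X = 0` only the dominant point survives: `redEntry(0) = w_y · dirE P S (w+δ_y) T'` when `y ∈ S` is STRICTLY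
dominant (`r y < r a` for `a ≠ y`). -/
theorem eval_zero_redEntry (P : π → κ → R) (r : π → ℕ) (S : Finset π) (w : π → ℕ) (y : π) (hyS : y ∈ S)
    (hdom : ∀ a ∈ S, a ≠ y → r y < r a) (T' : Finset κ) :
    (redEntry P r S w y T').eval 0 = (w y : R) * dirE P S (Function.update w y (w y + 1)) T' := by
  rw [redEntry, eval_finsetSum, Finset.sum_eq_single (⟨y, hyS⟩ : ↥S)]
  · simp
  · intro a _ ha
    have hne : (a : π) ≠ y := fun e => ha (Subtype.ext e)
    have hpos : 0 < r a - r y := Nat.sub_pos_of_lt (hdom a a.2 hne)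
    simp [zero_pow (Nat.pos_iff_ne_zero.mp hpos)]
  · intro h
    exact absurd (Finset.mem_univ _) h

variable [IsDomain R]

/-- **THE LEADING TERM OF A `c`-BLOCK (dominance lemma).**  Rows `(S i, w i)` with a STRICTLY dominant point `y i ∈ S i`
for the rank function `r` (smaller rank = lower height power = dominant as `x → 0`), columns `T' j + c` (`c ∉ T' j`), heights
`x^{r a}` in coordinate `c`.  If the REWEIGHTED matrix `[dirE P (S i) (w i + δ_{y i}) (T' j)]` is nonsingular and the dominant
weights `w i (y i)` are nonzero in `R`, then the `c`-block determinant at the height table is a nonzero polynomial in `x`: it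
equals `x^{Σ r(y i)} · det(redEntry)`, and `det(redEntry)(0) = ∏ w i (y i) · det(reweighted)`. -/
theorem det_cBlock_heightTable_ne_zero (P : π → κ → R) (c : κ) (r : π → ℕ) (S : ι → Finset π) (w : ι → π → ℕ)
    (y : ι → π) (hyS : ∀ i, y i ∈ S i) (hdom : ∀ i, ∀ a ∈ S i, a ≠ y i → r (y i) < r a)
    (hw : ∀ i, (w i (y i) : R) ≠ 0) (T' : ι → Finset κ) (hc : ∀ j, c ∉ T' j)
    (hdet : (Matrix.of fun i j : ι => dirE P (S i) (Function.update (w i) (y i) (w i (y i) + 1)) (T' j)).det ≠ 0) :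
    (Matrix.of fun i j : ι => dirE (heightTable P c r) (S i) (w i) (insert c (T' j))).det ≠ 0 := by
  classical
  set N : Matrix ι ι R[X] := Matrix.of fun i j => redEntry P r (S i) (w i) (y i) (T' j) with hN
  have hfac : (Matrix.of fun i j : ι => dirE (heightTable P c r) (S i) (w i) (insert c (T' j))) =
      Matrix.of fun i j => (fun i => (X : R[X]) ^ r (y i)) i * N i j := by
    refine Matrix.ext fun i j => ?_
    rw [Matrix.of_apply, Matrix.of_apply, hN, Matrix.of_apply]
    exact dirE_heightTable_eq_mul_redEntry P c r (S i) (w i) (y i)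
      (fun a ha => by
        by_cases e : a = y i
        · rw [e]
        · exact le_of_lt (hdom i a ha e)) (hc j)
  rw [hfac, Matrix.det_mul_column]
  refine mul_ne_zero (Finset.prod_ne_zero_iff.mpr fun i _ => pow_ne_zero _ Polynomial.X_ne_zero) ?_
  -- `det N` does not vanish at `0`
  intro h0
  have h1 : (N.det).eval 0 = 0 := by rw [h0, eval_zero]
  have h2 : (N.det).eval 0 = (Matrix.of fun i j : ι => (redEntry P r (S i) (w i) (y i) (T' j)).eval 0).det := by
    have := RingHom.map_det (Polynomial.evalRingHom (0 : R)) N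
    rw [Polynomial.coe_evalRingHom] at this
    rw [this]
    congr 1
  have h3 : (Matrix.of fun i j : ι => (redEntry P r (S i) (w i) (y i) (T' j)).eval 0) =
      Matrix.of fun i j : ι => (fun i => (w i (y i) : R)) i *
        (Matrix.of fun i j : ι => dirE P (S i) (Function.update (w i) (y i) (w i (y i) + 1)) (T' j)) i j := by
    ext i j
    rw [Matrix.of_apply, Matrix.of_apply, Matrix.of_apply, eval_zero_redEntry P r (S i) (w i) (y i) (hyS i) (hdom i)]
  rw [h2, h3, Matrix.det_mul_column] at h1
  exact (mul_ne_zero (Finset.prod_ne_zero_iff.mpr fun i _ => hw i) hdet) h1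

omit [IsDomain R] in
/-- Evaluating the height table at `x`: coordinate `c` carries `x^{r a}`. -/
theorem eval_det_heightTable (P : π → κ → R) (c : κ) (r : π → ℕ) (S : ι → Finset π) (w : ι → π → ℕ)
    (T : ι → Finset κ) (x : R) :
    ((Matrix.of fun i j : ι => dirE (heightTable P c r) (S i) (w i) (T j)).det).eval x =
      (Matrix.of fun i j : ι => dirE (setCol P c (fun a => x ^ r a)) (S i) (w i) (T j)).det := by
  classical
  have h1 : (Polynomial.evalRingHom x) (Matrix.of fun i j : ι => dirE (heightTable P c r) (S i) (w i) (T j)).det =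
      ((Polynomial.evalRingHom x).mapMatrix (Matrix.of fun i j : ι => dirE (heightTable P c r) (S i) (w i) (T j))).det :=
    RingHom.map_det _ _
  rw [Polynomial.coe_evalRingHom] at h1
  rw [h1]
  congr 1
  ext i j
  rw [RingHom.mapMatrix_apply, Matrix.map_apply, Matrix.of_apply, Matrix.of_apply, Polynomial.coe_evalRingHom,
    ← Polynomial.coe_evalRingHom, map_dirE]
  congr 1
  funext a c'
  by_cases e : c' = c
  · subst e; simp [heightTable, setCol]
  · simp [heightTable, setCol, e]

/-- **MULTI-POINT COORDINATE SPLIT, `c`-block, cofinite form.**  Under the hypotheses of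
`det_cBlock_heightTable_ne_zero`, all but finitely many height scalars `x` (coordinate `c` of the point `a` set to `x^{r a}`)
make the `c`-block `[dirE · (S i) (w i) (T' j + c)]` nonsingular. -/
theorem cBlock_split_finite (P : π → κ → R) (c : κ) (r : π → ℕ) (S : ι → Finset π) (w : ι → π → ℕ)
    (y : ι → π) (hyS : ∀ i, y i ∈ S i) (hdom : ∀ i, ∀ a ∈ S i, a ≠ y i → r (y i) < r a)
    (hw : ∀ i, (w i (y i) : R) ≠ 0) (T' : ι → Finset κ) (hc : ∀ j, c ∉ T' j)
    (hdet : (Matrix.of fun i j : ι => dirE P (S i) (Function.update (w i) (y i) (w i (y i) + 1)) (T' j)).det ≠ 0) :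
    Set.Finite {x : R | (Matrix.of fun i j : ι =>
      dirE (setCol P c (fun a => x ^ r a)) (S i) (w i) (insert c (T' j))).det = 0} := by
  have hne := det_cBlock_heightTable_ne_zero P c r S w y hyS hdom hw T' hc hdet
  refine (Polynomial.finite_setOf_isRoot hne).subset fun x hx => ?_
  rw [Set.mem_setOf_eq, Polynomial.IsRoot.def, eval_det_heightTable]
  exact hx

/-- **MULTI-POINT COORDINATE SPLIT, `c`-block** (over an infinite domain, e.g. `ℂ`): some choice of heights works. -/
theorem cBlock_split [Infinite R] (P : π → κ → R) (c : κ) (r : π → ℕ) (S : ι → Finset π) (w : ι → π → ℕ)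
    (y : ι → π) (hyS : ∀ i, y i ∈ S i) (hdom : ∀ i, ∀ a ∈ S i, a ≠ y i → r (y i) < r a)
    (hw : ∀ i, (w i (y i) : R) ≠ 0) (T' : ι → Finset κ) (hc : ∀ j, c ∉ T' j)
    (hdet : (Matrix.of fun i j : ι => dirE P (S i) (Function.update (w i) (y i) (w i (y i) + 1)) (T' j)).det ≠ 0) :
    ∃ x : R, (Matrix.of fun i j : ι =>
      dirE (setCol P c (fun a => x ^ r a)) (S i) (w i) (insert c (T' j))).det ≠ 0 := by
  have hfin := cBlock_split_finite P c r S w y hyS hdom hw T' hc hdet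
  obtain ⟨x, hx⟩ := Set.Infinite.nonempty (Set.Finite.infinite_compl hfin)
  exact ⟨x, hx⟩

end Dominance

end Summit.ValiantsHypothesis.ValiantsHypothesis.Theorems.BarrierLever.ChowBenchmarkSplit
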